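import Summits.KontsevichZagierPeriods.KontsevichZagierPeriods.Theses.TorsionLogs
import Summits.KontsevichZagierPeriods.KontsevichZagierPeriods.Theorems.TorsionLogsNeronTorsionSector

/-!
# Witness of weakness (F3 / BC5) for the rung family `NeronTorsionShiftedSector ξ` — line `shifted_eta_sector`
# (crux `TorsionSectorComplete`, stmt-KontsevichZagierPeriods-14212; route `TorsionLogs`, route-KontsevichZagierPeriods-TorsionLogs)

`NeronTorsionShiftedSector 0` IS the floor: after `Rat.cast_zero` / `zero_mul` / `add_zero` / `sub_zero` it is
syntactically the tied crux `Theses.TorsionLogs.NeronTorsionSector` (item stmt-KontsevichZagierPeriods-14500, closed),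
which the seed theorem `Cruxes.NeronTorsionSector.Translation.stub_assembly` (item stmt-KontsevichZagierPeriods-17981
`NeronTorsionPrimitiveChain`, seed g1-KontsevichZagierPeriods-17981) proves through the landed bookkeeping
`NeronTorsionSector_of_primitiveChain` (`Theorems/TorsionLogsNeronTorsionSector.lean`).  Two forms below:
`of_tied` = pure instantiation of the family parameter (`ξ := 0`), `rung_zero` = the 3-line proof naming the seed.
The rung is `∀ ξ : ℚ, NeronTorsionShiftedSector ξ`: for `ξ < e₁ ≤ 0` (real curves with `Δ < 0 ∧ g₃ ≤ 0`, e.g.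
`y² = 4x³ + 4` with the 3-torsion point `(0, 1)`) the floor's carrier `(g₂x′+2g₃)dx′/(4x′²y′)` has its pole inside
`[e₁, ∞)` and the floor's proof (`AssemblyIface.lean:105–120`, `he₁pos`) does not run — tribunal forward kernel:
`floor → rung` open, `real_step=true`.
witness_regime: real Weierstrass models over `ℚ̄ ∩ ℝ` with a rational torsion point on the identity component;
Conjecture 1 (the sub-problem statement) is NOT known for this family in any regime — the value identity realised is
quadratic in 1-periods (`I(P)`, `ω₁η₁`, `log α`), outside the proved linear theory of 1-periods
(Huber–Wüstholz 2022, Thm 9.10; Rem 13.2(3)).  This discharges the [nec]-trap: the rung is a consequence of S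
(`Lines/NeronTorsionShiftedSectors_onpath.lean`) pinned at `ξ = 0` to a PROVED floor, and neither probe
`floor → rung` nor `rung → S` closes.
Self-contained: a verbatim copy of the `def`s of `Lines/shifted_eta_sector.lean` in the namespace `…ShiftedEtaSector.Special`
(the skeleton module carries the same witness `neronTorsionShiftedSector_zero` about the registered decl).
-/

-- `Summit.KontsevichZagierPeriods.KontsevichZagierPeriods.…` is the tree's mandated layout (single-conjunct summit).
set_option linter.dupNamespace false

namespace Summit.KontsevichZagierPeriods.KontsevichZagierPeriods.Cruxes.TorsionSectorComplete.ShiftedEtaSector.Special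

open Summit.KontsevichZagierPeriods.KontsevichZagierPeriods.Cruxes.NeronTorsionSector.Translation
  (NeronTorsionSector_of_primitiveChain stub_assembly)

/-- The tied Néron–torsion sector with the η-carrier shifted to the rational pole `x′ = ξ < e₁`
(`NeronTorsionSector` verbatim except `0 < e₁ ↦ (ξ:ℝ) < e₁` and the carrier `h₀ ↦ h_ξ`). [cite: KontsevichZagier2001, §1.2] -/
def NeronTorsionShiftedSector (ξ : ℚ) : Prop :=
  ∀ (g₂ g₃ e₁ xP yP α : ℝ) (N a : ℕ) (M k m : ℤ) (f : ℝ → ℝ), (∀ x, f x = 4 * x ^ 3 - g₂ * x - g₃) → g₂ ^ 3 - 27 * g₃ ^ 2 ≠ 0 → f e₁ = 0 → (ξ : ℝ) < e₁ → (∀ x, e₁ < x → 0 < f x) → e₁ < xP → yP ^ 2 = f xP → 3 ≤ N → 0 < a → 2 * a < N → 4 * (N : ℤ) ^ 2 * k = M * ((N : ℤ) - 2 * (a : ℤ)) ^ 2 → (∀ hns : (⟨0, 0, 0, -g₂ / 4, -g₃ / 4⟩ : WeierstrassCurve ℝ).toAffine.Nonsingular xP (yP / 2), addOrderOf (WeierstrassCurve.Affine.Point.some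 xP (yP / 2) hns) = N) → (N : ℝ) * (∫ x in Set.Ioi xP, (Real.sqrt (f x))⁻¹) = a * (2 * ∫ x in Set.Ioi e₁, (Real.sqrt (f x))⁻¹) → 1 < α → ∀ (rI rP : Literature.NumberTheory.Transcendental.KZ.IntegralRep 2) (rL : Literature.NumberTheory.Transcendental.KZ.IntegralRep 1), rI.domain = {z | e₁ < z 1 ∧ z 1 < z 0 ∧ z 0 < xP} → Set.EqOn rI.integrand (fun z => z 1 / (Real.sqrt (f (z 1)) * Real.sqrt (f (z 0)))) rI.domain → rP.domain = {z | e₁ < z 0 ∧ e₁ < z 1} → Set.EqOn rP.integrand (fun z => (Real.sqrt (f (z 0)))⁻¹ * ((g₂ * z 1 + 2 * g₃ + (ξ : ℝ) * (g₂ - 4 * (z 1) ^ 2 - 4 * (ξ : ℝ) * z 1)) / (2 * (z 1 - (ξ : ℝ)) ^ 2 * Real.sqrt (f (z 1))))) rP.domain → rL.domain = {t | 1 < t 0 ∧ t 0 < α} → Set.EqOn rL.integrand (fun t => (t 0)⁻¹) rL.domain → (M : ℝ) * rI.value + k * rP.value = m * rL.value → M • Literature.NumberTheory.Transcendental.KZ.of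 rI + k • Literature.NumberTheory.Transcendental.KZ.of rP - m • Literature.NumberTheory.Transcendental.KZ.of rL ∈ Literature.NumberTheory.Transcendental.KZ.relations

/-- **THE RUNG** (`rung_decl`): the shifted Néron–torsion sector for every rational pole `ξ`. -/
def NeronTorsionShiftedSectors : Prop :=
  ∀ ξ : ℚ, NeronTorsionShiftedSector ξ


/-- Pure instantiation: the tied floor crux is the member `ξ = 0` (only `simp` normalisation of `((0:ℚ):ℝ)`). -/
theorem of_tied (h : Summit.KontsevichZagierPeriods.KontsevichZagierPeriods.Theses.TorsionLogs.NeronTorsionSector) :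
    NeronTorsionShiftedSector 0 := by
  simpa [NeronTorsionShiftedSector,
    Summit.KontsevichZagierPeriods.KontsevichZagierPeriods.Theses.TorsionLogs.NeronTorsionSector] using h

/-- **F3 witness**: `Rung 0` from the SEED THEOREM `stub_assembly` (seed g1-KontsevichZagierPeriods-17981). -/
theorem rung_zero : NeronTorsionShiftedSector 0 :=
  of_tied (NeronTorsionSector_of_primitiveChain stub_assembly)

example : NeronTorsionShiftedSector 0 := by
  simpa [NeronTorsionShiftedSector] using
    (NeronTorsionSector_of_primitiveChain stub_assembly :
      Summit.KontsevichZagierPeriods.KontsevichZagierPeriods.Theses.TorsionLogs.NeronTorsionSector)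

end Summit.KontsevichZagierPeriods.KontsevichZagierPeriods.Cruxes.TorsionSectorComplete.ShiftedEtaSector.Special
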